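import Summits.FinalStateConjecture.FinalStateConjecture.Statement

/-!
# Solo (blind) — the typed path: censorship / resolution / instability

The final state conjecture as typed (`FinalStateConjecture`) is EQUIVALENT to the existence, on
every Cauchy manifold `Σ`, of an exceptional class `E_Σ` of data for which four separate
statements hold (`soloBlind_statement_iff_path`):

* `SoloBlindMGHDOff Σ E`        — O1, **maximal developments exist** for admissible data off `E`
  (Choquet-Bruhat–Geroch 1969 gives it for all data; in the tree a named fact, not a theorem);
* `SoloBlindCensorshipOff Σ E`  — O2, **pointwise weak cosmic censorship off `E`**: every MGHD of
  an admissible datum outside `E` has complete future null infinity (Christodoulou, CQG 16 (1999),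
  p. A27);
* `SoloBlindResolutionOff Σ E`  — O3, **exterior Kerr resolution off `E`**: every MGHD with
  complete `𝓘⁺` of an admissible datum outside `E` settles on `J⁺(Σ) ∩ I⁻(charted)` to finitely
  many subextremal Kerr exteriors plus radiation, with the rays / exhaustion / orientation
  clauses (Dafermos–Luk arXiv:1710.01722, §1; Penrose 1982, Problem 12);
* `SoloBlindInstabilityOf Σ E`  — O4, **Christodoulou instability of `E`**: `𝓓_Σ ∩ E` has tame
  codimension `≥ 1` inside the admissible class (Christodoulou, Ann. Math. 149 (1999), p. 187).

`soloBlind_of_path` is the assembly O1 ∧ O2 ∧ O3 ∧ O4 (for some `E` on every `Σ`) ⇒ summit;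
`soloBlind_path_of_statement` the converse with `E` = the exceptional set. The equivalence is
elementary (tame codimension is antitone in the exceptional set); its point is to fix, in the
tree's vocabulary, the three mechanisms any proof must supply SIMULTANEOUSLY FOR ONE CLASS `E` —
tame genericity is not closed under conjunction, so generic censorship and generic settling
proved for different exceptional classes would not combine: censorship (O2) and resolution (O3)
are pointwise statements about single large-data solutions, and instability (O4) is the only
place where genericity enters.
-/

noncomputable section

open Literature.Geometry.Lorentzian Set
open scoped Manifold ContDiff

namespace Summit.FinalStateConjecture.FinalStateConjecture.Theorems

section Obligations

variable (X : Type) [TopologicalSpace X] [ChartedSpace E3 X] [IsManifold (𝓡 3) ∞ X]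
  [ConnectedSpace X] (E : Set (InitialDataSet (𝓡 3) X))

/-- **O1 — existence of a maximal globally hyperbolic vacuum development** for every admissible
datum outside `E`. Choquet-Bruhat–Geroch, CMP 14 (1969), Thm. 3 (for all data). -/
def SoloBlindMGHDOff : Prop :=
  ∀ D ∈ admissibleVacuumData X, D ∉ E → ∃ 𝒟 : VacuumCauchyDevelopment D, 𝒟.IsMaximal

/-- **O2 — pointwise weak cosmic censorship off `E`**: every MGHD of an admissible datum outside
`E` has complete future null infinity (sojourn form). Christodoulou, CQG 16 (1999), p. A27. -/
def SoloBlindCensorshipOff : Prop :=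
  ∀ D ∈ admissibleVacuumData X, D ∉ E → ∀ 𝒟 : VacuumCauchyDevelopment D, 𝒟.IsMaximal →
    Summit.FinalStateConjecture.HasCompleteNullInfinity 𝒟.toCauchyDevelopment

/-- **O3 — exterior Kerr resolution off `E`**: every MGHD with complete `𝓘⁺` of an admissible
datum outside `E` settles down on its exterior to finitely many subextremal Kerr black holes plus
radiation (all clauses of the statement). Dafermos–Luk arXiv:1710.01722, §1. -/
def SoloBlindResolutionOff : Prop :=
  ∀ D ∈ admissibleVacuumData X, D ∉ E → ∀ 𝒟 : VacuumCauchyDevelopment D, 𝒟.IsMaximal →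
    Summit.FinalStateConjecture.HasCompleteNullInfinity 𝒟.toCauchyDevelopment →
      ∃ (O : Set 𝒟.carrier) (d : FinalStateDecomposition 𝒟.toSpacetime O 2),
        (∀ i, Kerr.IsSubextremal (d.mass i) (d.spin i)) ∧
          O = Summit.FinalStateConjecture.exteriorOf 𝒟.toCauchyDevelopment d.charted ∧
            Summit.FinalStateConjecture.RaysStayInClosure 𝒟.toCauchyDevelopment O ∧
              Summit.FinalStateConjecture.HasExhaustiveCharts d ∧
                Summit.FinalStateConjecture.IsFutureOriented d

/-- **O4 — Christodoulou instability of the exceptional class**: `𝓓 ∩ E` has tame codimension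
`≥ 1` inside the admissible class. Christodoulou, Ann. Math. 149 (1999), p. 187. -/
def SoloBlindInstabilityOf : Prop :=
  InitialDataSet.HasTameCodimAtLeastIn (admissibleVacuumData X) (admissibleVacuumData X ∩ E) 1

/-- **The pointwise final-state property of the statement** for one datum (the predicate whose
tame genericity `FinalStateConjecture` asserts, copied verbatim). -/
def SoloBlindPointwise (D : InitialDataSet (𝓡 3) X) : Prop :=
  (∃ 𝒟 : VacuumCauchyDevelopment D, 𝒟.IsMaximal) ∧
    ∀ 𝒟 : VacuumCauchyDevelopment D, 𝒟.IsMaximal →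
      Summit.FinalStateConjecture.HasCompleteNullInfinity 𝒟.toCauchyDevelopment ∧
        ∃ (O : Set 𝒟.carrier) (d : FinalStateDecomposition 𝒟.toSpacetime O 2),
          (∀ i, Kerr.IsSubextremal (d.mass i) (d.spin i)) ∧
            O = Summit.FinalStateConjecture.exteriorOf 𝒟.toCauchyDevelopment d.charted ∧
              Summit.FinalStateConjecture.RaysStayInClosure 𝒟.toCauchyDevelopment O ∧
                Summit.FinalStateConjecture.HasExhaustiveCharts d ∧
                  Summit.FinalStateConjecture.IsFutureOriented d

variable {X E}

/-- O1 ∧ O2 ∧ O3 give the pointwise final-state property off `E`. -/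
theorem soloBlindPointwise_of_obligations (h1 : SoloBlindMGHDOff X E)
    (h2 : SoloBlindCensorshipOff X E) (h3 : SoloBlindResolutionOff X E)
    {D : InitialDataSet (𝓡 3) X} (hD : D ∈ admissibleVacuumData X) (hDE : D ∉ E) :
    SoloBlindPointwise X D :=
  ⟨h1 D hD hDE, fun 𝒟 h𝒟 ↦
    ⟨h2 D hD hDE 𝒟 h𝒟, h3 D hD hDE 𝒟 h𝒟 (h2 D hD hDE 𝒟 h𝒟)⟩⟩

/-- Conversely the pointwise property off `E` gives O1, O2, O3. -/
theorem obligations_of_soloBlindPointwise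
    (h : ∀ D ∈ admissibleVacuumData X, D ∉ E → SoloBlindPointwise X D) :
    SoloBlindMGHDOff X E ∧ SoloBlindCensorshipOff X E ∧ SoloBlindResolutionOff X E :=
  ⟨fun D hD hDE ↦ (h D hD hDE).1, fun D hD hDE 𝒟 h𝒟 ↦ ((h D hD hDE).2 𝒟 h𝒟).1,
    fun D hD hDE 𝒟 h𝒟 _ ↦ ((h D hD hDE).2 𝒟 h𝒟).2⟩

/-- **Pointwise-off-`E` plus instability of `E` gives tame genericity of the pointwise property**
(tame codimension is antitone in the exceptional set, and the exceptional set of the statement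
lies in `𝓓 ∩ E`). Christodoulou, CQG 16 (1999) A23, p. A24. -/
theorem soloBlind_generic_of_obligations (h1 : SoloBlindMGHDOff X E)
    (h2 : SoloBlindCensorshipOff X E) (h3 : SoloBlindResolutionOff X E)
    (h4 : SoloBlindInstabilityOf X E) :
    InitialDataSet.IsTameChristodoulouGeneric (admissibleVacuumData X) (SoloBlindPointwise X) 1 := by
  intro D hD
  have hDE : D ∈ admissibleVacuumData X ∩ E :=
    ⟨hD.1, by_contra fun hDE ↦ hD.2 (soloBlindPointwise_of_obligations h1 h2 h3 hD.1 hDE)⟩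
  obtain ⟨e, F, hT, hI, h0, hinj, hmem, hout⟩ := h4 D hDE
  exact ⟨e, F, hT, hI, h0, hinj, hmem, fun c hc hFc ↦ hout c hc ⟨hFc.1, by_contra fun hE ↦
    hFc.2 (soloBlindPointwise_of_obligations h1 h2 h3 hFc.1 hE)⟩⟩

/-- **Conversely, tame genericity of the pointwise property yields a class `E` with O1–O4**
(namely the exceptional set itself). -/
theorem soloBlind_obligations_of_generic
    (h : InitialDataSet.IsTameChristodoulouGeneric (admissibleVacuumData X)
      (SoloBlindPointwise X) 1) :
    ∃ E : Set (InitialDataSet (𝓡 3) X), SoloBlindMGHDOff X E ∧ SoloBlindCensorshipOff X E ∧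
      SoloBlindResolutionOff X E ∧ SoloBlindInstabilityOf X E := by
  set E : Set (InitialDataSet (𝓡 3) X) := {D ∈ admissibleVacuumData X | ¬ SoloBlindPointwise X D}
  have hE : ∀ D ∈ admissibleVacuumData X, D ∉ E → SoloBlindPointwise X D :=
    fun D hD hDE ↦ by_contra fun hP ↦ hDE ⟨hD, hP⟩
  refine ⟨E, (obligations_of_soloBlindPointwise hE).1, (obligations_of_soloBlindPointwise hE).2.1,
    (obligations_of_soloBlindPointwise hE).2.2, fun D hD ↦ ?_⟩
  obtain ⟨e, F, hT, hI, h0, hinj, hmem, hout⟩ := h D hD.2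
  exact ⟨e, F, hT, hI, h0, hinj, hmem, fun c hc hFc ↦ hout c hc hFc.2⟩

end Obligations

/-- **Assembly of the path**: exceptional classes `E_Σ` with O1–O4 on every `Σ` give the final
state conjecture. -/
theorem soloBlind_of_path
    (E : ∀ (X : Type) [TopologicalSpace X] [ChartedSpace E3 X] [IsManifold (𝓡 3) ∞ X],
      Set (InitialDataSet (𝓡 3) X))
    (h1 : ∀ (X : Type) [TopologicalSpace X] [ChartedSpace E3 X] [IsManifold (𝓡 3) ∞ X]
      [T2Space X] [SecondCountableTopology X] [ConnectedSpace X], SoloBlindMGHDOff X (E X))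
    (h2 : ∀ (X : Type) [TopologicalSpace X] [ChartedSpace E3 X] [IsManifold (𝓡 3) ∞ X]
      [T2Space X] [SecondCountableTopology X] [ConnectedSpace X], SoloBlindCensorshipOff X (E X))
    (h3 : ∀ (X : Type) [TopologicalSpace X] [ChartedSpace E3 X] [IsManifold (𝓡 3) ∞ X]
      [T2Space X] [SecondCountableTopology X] [ConnectedSpace X], SoloBlindResolutionOff X (E X))
    (h4 : ∀ (X : Type) [TopologicalSpace X] [ChartedSpace E3 X] [IsManifold (𝓡 3) ∞ X]
      [T2Space X] [SecondCountableTopology X] [ConnectedSpace X], SoloBlindInstabilityOf X (E X)) :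
    FinalStateConjecture :=
  fun X _ _ _ _ _ _ ↦ soloBlind_generic_of_obligations (h1 X) (h2 X) (h3 X) (h4 X)

/-- **Completeness of the path**: the final state conjecture yields, on every `Σ`, a class `E`
(its exceptional set) satisfying O1–O4. -/
theorem soloBlind_path_of_statement (h : FinalStateConjecture) (X : Type) [TopologicalSpace X]
    [ChartedSpace E3 X] [IsManifold (𝓡 3) ∞ X] [T2Space X] [SecondCountableTopology X]
    [ConnectedSpace X] :
    ∃ E : Set (InitialDataSet (𝓡 3) X), SoloBlindMGHDOff X E ∧ SoloBlindCensorshipOff X E ∧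
      SoloBlindResolutionOff X E ∧ SoloBlindInstabilityOf X E :=
  soloBlind_obligations_of_generic (h X)

/-- **The typed path is an equivalence**: `FinalStateConjecture ↔ ∀ Σ, ∃ E, O1 ∧ O2 ∧ O3 ∧ O4`. -/
theorem soloBlind_statement_iff_path :
    FinalStateConjecture ↔
      ∀ (X : Type) [TopologicalSpace X] [ChartedSpace E3 X] [IsManifold (𝓡 3) ∞ X] [T2Space X]
        [SecondCountableTopology X] [ConnectedSpace X],
        ∃ E : Set (InitialDataSet (𝓡 3) X), SoloBlindMGHDOff X E ∧ SoloBlindCensorshipOff X E ∧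
          SoloBlindResolutionOff X E ∧ SoloBlindInstabilityOf X E := by
  refine ⟨fun h X _ _ _ _ _ _ ↦ soloBlind_path_of_statement h X, fun h X _ _ _ _ _ _ ↦ ?_⟩
  obtain ⟨E, h1, h2, h3, h4⟩ := h X
  exact soloBlind_generic_of_obligations h1 h2 h3 h4

end Summit.FinalStateConjecture.FinalStateConjecture.Theorems

end
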